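import Summits.AtomisticToContinuum.Crystallization.Theorems.ThreeConeCertificateSlackRigidityLawCellAverage
import HarnessLib

/-!
# Law rigidity, energy side: the cell average of the local energy is the cluster energy per particle

Support file for the crux `ThreeConeCertificate.SlackRigidity` (stmt-AtomisticToContinuum-11960), line
`ekeland-surgery-parity`, lead c14's law-rigidity programme.  The cell-averaging identity
(`SlackRigidityLawCellAverage.lintegral_phase_eq_cellAverage`) applied to the energy functional of item
9229, `f_E(μ, v) = ofReal (locEnergy δ μ (rootCell L v) + C_δ)`:

* `cellAvg_energy_eq` — at a rooted hard-core configuration `count|S` and phase `v` with cluster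
  `T = rootCell L v ∩ S`, the cell average of `f_E` is EXACTLY `ofReal (𝓔(T)/#T + C_δ)`, the
  Lennard-Jones energy per particle of the finite cluster (plus the constant);
* `lintegral_cellAvg_energy_le` — for a point-stationary law with `E_P[h] ≤ e*` its mean is at most
  `vol([0,1)³) · ofReal (e* + C_δ) + E_P[err_L]/12` (boundary error of item 9229), where
  `E_P[err_L] → 0` as `L → ∞` (`tendsto_lintegral_errTerm`); since `𝓔(T)/#T ≥ e*`
  (`excess_per_particle_nonneg`, periodisation) this says: the root's cluster has mean energy excess
  `E_P[∫ ofReal (𝓔(T_v)/#T_v - e*) dv] ≤ E_P[err_L]/12 → 0` per particle;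
* `neg_cst_le_eStar` — under the same hypotheses `-C_δ ≤ e*` (so `ofReal` splits additively).
All `[folklore]`.
-/

noncomputable section

open MeasureTheory Filter
open scoped ENNReal BigOperators Topology

namespace Summit.AtomisticToContinuum.Crystallization.Theorems.SlackRigidityLawEnergy

open Literature.Probability.Process (IsPointStationaryLaw IsRootedHardCore
  count_restrict_singleton_ne_zero_iff map_sub_count_restrict)
open Literature.MathematicalPhysics.StatisticalMechanics (lennardJones interactionEnergy rootEnergy)
open Summit.AtomisticToContinuum.Crystallization.Theorems.PalmUnimodularRigidityMinimiserShells.EnergyFloor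
open Summit.AtomisticToContinuum.Crystallization.Theorems.MinimiserShells.Negative.LoadBearing (eStar)
open Summit.AtomisticToContinuum.Crystallization.Theorems.MinimiserShells.Negative.Rootedness
  (countable_of_separated)
open Summit.AtomisticToContinuum.Crystallization.Theorems.ChargedEnergyGapNegative (card_mul_eStar_le)
open Summit.AtomisticToContinuum.Crystallization.Theorems.SlackRigidityLawCellAverage
  (lintegral_phase_eq_cellAverage)

variable {δ L : ℝ}

/-! ## The energy functional `f_E(μ, v) = ofReal (locEnergy δ μ (rootCell L v) + C_δ)` -/

/-- The energy functional is jointly measurable. [folklore] -/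
theorem measurable_energyFunctional (δ L : ℝ) :
    Measurable (Function.uncurry fun (μ : Measure (EuclideanSpace ℝ (Fin 3)))
      (v : EuclideanSpace ℝ (Fin 3)) => ENNReal.ofReal (locEnergy δ μ (rootCell L v) + cst δ)) :=
  ENNReal.measurable_ofReal.comp ((measurable_locEnergy_rootCell δ L).add_const _)

/-- The energy functional is `ℤ³`-periodic in the phase. [folklore] -/
theorem energyFunctional_periodic (δ L : ℝ) :
    ∀ (μ : Measure (EuclideanSpace ℝ (Fin 3))) (k v : EuclideanSpace ℝ (Fin 3)),
      (∀ i, ∃ m : ℤ, k i = m) →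
      ENNReal.ofReal (locEnergy δ μ (rootCell L (k + v)) + cst δ) =
        ENNReal.ofReal (locEnergy δ μ (rootCell L v) + cst δ) := by
  intro μ k v hk
  rw [rootCell_int_add hk]

/-! ## The cell average of the energy functional is the cluster energy per particle -/

variable {S : Set (EuclideanSpace ℝ (Fin 3))}

/-- **Periodisation**: the energy per particle of a finite cluster is at least `e*`. [folklore] -/
theorem excess_per_particle_nonneg {T : Finset (EuclideanSpace ℝ (Fin 3))} (hT : 0 < T.card) :
    0 ≤ interactionEnergy lennardJones
        (fun i : Fin T.card => ((T.equivFin.symm i : T) : EuclideanSpace ℝ (Fin 3))) / T.card - eStar := by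
  have h := card_mul_eStar_le (injective_enum T)
  change (T.card : ℝ) * eStar ≤ _ at h
  have hc : (0 : ℝ) < T.card := by exact_mod_cast hT
  rw [sub_nonneg, le_div_iff₀ hc, mul_comm]
  exact h

/-- **The cell average of `f_E` is the cluster energy per particle.** At a rooted hard-core
configuration `count|S`, phase `v`, cluster `T = rootCell L v ∩ S`:
`(∑_{y ∈ T} f_E(θ_y μ, v - L⁻¹ y)) / #T = ofReal (𝓔(T)/#T + C_δ)`. [folklore] -/
theorem cellAvg_energy_eq (hδ : 0 < δ) (hL : 0 < L) (h0 : (0 : EuclideanSpace ℝ (Fin 3)) ∈ S)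
    (hsep : ∀ x ∈ S, ∀ y ∈ S, x ≠ y → δ ≤ dist x y) {T : Finset (EuclideanSpace ℝ (Fin 3))}
    {v : EuclideanSpace ℝ (Fin 3)} (hT : (↑T : Set (EuclideanSpace ℝ (Fin 3))) = rootCell L v ∩ S) :
    (∫⁻ y in rootCell L v, ENNReal.ofReal (locEnergy δ
        ((((Measure.count : Measure (EuclideanSpace ℝ (Fin 3))).restrict S).map fun z => z - y))
        (rootCell L (v - L⁻¹ • y)) + cst δ)
        ∂((Measure.count : Measure (EuclideanSpace ℝ (Fin 3))).restrict S)) /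
      ((Measure.count : Measure (EuclideanSpace ℝ (Fin 3))).restrict S) (rootCell L v) =
    ENNReal.ofReal (interactionEnergy lennardJones
        (fun i : Fin T.card => ((T.equivFin.symm i : T) : EuclideanSpace ℝ (Fin 3))) / T.card + cst δ) := by
  have h0T : (0 : EuclideanSpace ℝ (Fin 3)) ∈ T := by
    rw [← Finset.mem_coe, hT]; exact ⟨zero_mem_rootCell L v, h0⟩
  have hcard : 0 < T.card := Finset.card_pos.2 ⟨0, h0T⟩
  have hcr : (0 : ℝ) < T.card := by exact_mod_cast hcard
  rw [setLIntegral_rootCell_eq_sum hT, count_restrict_rootCell_eq_card hT,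
    Finset.sum_congr rfl fun y hy => by rw [(share_map_sub_eq hδ hL h0 hsep hT hy).1]]
  have hnonneg : ∀ y ∈ T, 0 ≤ (∑ z ∈ T, lennardJones ‖z - y‖) / 2 + cst δ := by
    intro y hy
    rw [← (share_map_sub_eq hδ hL h0 hsep hT hy).1]
    refine locEnergy_add_cst_nonneg hδ ?_ _
    have hyS : y ∈ rootCell L v ∩ S := by rw [← hT]; exact hy
    exact (show IsRootedHardCore δ ((Measure.count : Measure (EuclideanSpace ℝ (Fin 3))).restrict S)
      from ⟨S, h0, hsep, rfl⟩).map_sub ((count_restrict_singleton_ne_zero_iff S y).2 hyS.2)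
  rw [← ENNReal.ofReal_sum_of_nonneg hnonneg, Finset.sum_add_distrib, sum_half_sum_eq_interactionEnergy,
    Finset.sum_const, nsmul_eq_mul, ← ENNReal.ofReal_natCast, ← ENNReal.ofReal_div_of_pos hcr]
  congr 1
  field_simp

/-! ## The mean of the cell average of the energy functional -/

/-- Under `E_P[h] ≤ e*`: `-C_δ ≤ e*` (the root energy of a rooted `δ`-hard-core configuration is
`≥ -C_δ`). [folklore] -/
theorem neg_cst_le_eStar (hδ : 0 < δ) (P : Measure (Measure (EuclideanSpace ℝ (Fin 3))))
    [IsProbabilityMeasure P] (hcore : ∀ᵐ μ ∂P, IsRootedHardCore δ μ)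
    (hE : (∫ μ, rootEnergy lennardJones μ ∂P) ≤ eStar) : -cst δ ≤ eStar := by
  have hbounds : ∀ᵐ μ ∂P, -cst δ ≤ rootEnergy' μ ∧ rootEnergy' μ ≤ 250 / 24 * δ⁻¹ ^ 12 :=
    hcore.mono fun μ hμ => by
      obtain ⟨h1, h2⟩ := rootEnergy'_bounds_of_hc hδ hμ
      unfold cst
      exact ⟨h1, h2⟩
  have hC0 : 0 ≤ cst δ := cst_nonneg δ
  have hint' : Integrable rootEnergy' P := by
    refine Integrable.of_bound measurable_rootEnergy'.aestronglyMeasurable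
      (cst δ + 250 / 24 * δ⁻¹ ^ 12) (hbounds.mono fun μ hμ => ?_)
    rw [Real.norm_eq_abs, abs_le]
    have : (0 : ℝ) ≤ 250 / 24 * δ⁻¹ ^ 12 := by positivity
    constructor <;> linarith [hμ.1, hμ.2]
  have hae : (fun μ : Measure (EuclideanSpace ℝ (Fin 3)) => rootEnergy lennardJones μ) =ᵐ[P]
      rootEnergy' := hcore.mono fun μ hμ => by
    show rootEnergy lennardJones μ = rootEnergy' μ
    rw [Literature.MathematicalPhysics.StatisticalMechanics.rootEnergy_def]
    exact (rootEnergy'_eq_of_hc hδ hμ).symm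
  have h1 : (∫ _μ, (-cst δ) ∂P) ≤ ∫ μ, rootEnergy' μ ∂P :=
    integral_mono_ae (integrable_const _) hint' (hbounds.mono fun μ hμ => hμ.1)
  rw [integral_const, probReal_univ, one_smul] at h1
  rw [integral_congr_ae hae] at hE
  exact h1.trans hE

/-- **`E_P[err_L] → 0`** as `L = n + 1 → ∞` (dominated convergence; `err_L ≤ 250 δ⁻⁶ vol`).
[folklore] -/
theorem tendsto_lintegral_errTerm (hδ : 0 < δ) (P : Measure (Measure (EuclideanSpace ℝ (Fin 3))))
    [IsProbabilityMeasure P] (hcore : ∀ᵐ μ ∂P, IsRootedHardCore δ μ) :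
    Tendsto (fun n : ℕ => ∫⁻ μ, errTerm ((n : ℝ) + 1) μ ∂P) atTop (𝓝 0) := by
  have hLs : Tendsto (fun n : ℕ => (n : ℝ) + 1) atTop atTop :=
    tendsto_atTop_add_const_right _ _ tendsto_natCast_atTop_atTop
  have h := tendsto_lintegral_of_dominated_convergence (μ := P)
    (F := fun n μ => errTerm ((n : ℝ) + 1) μ) (f := fun _ => 0)
    (fun _ => ENNReal.ofReal (250 * δ⁻¹ ^ 6) * volume phaseDom) (fun n => measurable_errTerm _)
    (fun n => hcore.mono fun μ hμ => errTerm_le hδ hμ _)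
    (by
      rw [lintegral_const, measure_univ, mul_one]
      exact ENNReal.mul_ne_top ENNReal.ofReal_ne_top volume_phaseDom_ne_top)
    (hcore.mono fun μ hμ => tendsto_errTerm hδ hμ hLs)
  simpa using h

/-- **Mean of the cell-averaged energy functional.** For a point-stationary `δ`-hard-core
probability law with `E_P[h] ≤ e*`,
`E_P[ ∫ cellAvg(f_E) dv ] ≤ vol([0,1)³) · ofReal (e* + C_δ) + E_P[err_L]/12`. [folklore] -/
theorem lintegral_cellAvg_energy_le (hδ : 0 < δ) (hL : 0 < L)
    (P : Measure (Measure (EuclideanSpace ℝ (Fin 3)))) [IsProbabilityMeasure P]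
    (hcore : ∀ᵐ μ ∂P, IsRootedHardCore δ μ) (hstat : IsPointStationaryLaw P)
    (hE : (∫ μ, rootEnergy lennardJones μ ∂P) ≤ eStar) :
    ∫⁻ μ, (∫⁻ v in phaseDom, (∫⁻ y in rootCell L v, ENNReal.ofReal (locEnergy δ (μ.map fun z => z - y)
        (rootCell L (v - L⁻¹ • y)) + cst δ) ∂μ) / μ (rootCell L v)) ∂P ≤
      volume phaseDom * ENNReal.ofReal (eStar + cst δ) +
        ENNReal.ofReal (1 / 12) * ∫⁻ μ, errTerm L μ ∂P := by
  set D : ℝ≥0∞ := volume phaseDom with hD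
  have hmeasI : Measurable fun μ : Measure (EuclideanSpace ℝ (Fin 3)) =>
      ENNReal.ofReal (rootEnergy' μ + cst δ) :=
    ENNReal.measurable_ofReal.comp (measurable_rootEnergy'.add_const _)
  -- the identity, then the boundary error of item 9229
  rw [← lintegral_phase_eq_cellAverage hδ hL (measurable_energyFunctional δ L)
    (energyFunctional_periodic δ L) hcore hstat]
  have hstep : ∫⁻ μ, (∫⁻ v in phaseDom, ENNReal.ofReal (locEnergy δ μ (rootCell L v) + cst δ)) ∂P ≤
      D * ∫⁻ μ, ENNReal.ofReal (rootEnergy' μ + cst δ) ∂P + ENNReal.ofReal (1 / 12) * ∫⁻ μ, errTerm L μ ∂P := by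
    calc ∫⁻ μ, (∫⁻ v in phaseDom, ENNReal.ofReal (locEnergy δ μ (rootCell L v) + cst δ)) ∂P
        ≤ ∫⁻ μ, (D * ENNReal.ofReal (rootEnergy' μ + cst δ) +
            ENNReal.ofReal (1 / 12) * errTerm L μ) ∂P :=
          lintegral_mono_ae (hcore.mono fun μ hμ => setLIntegral_ofReal_locEnergy_le hδ _ hμ)
      _ = D * ∫⁻ μ, ENNReal.ofReal (rootEnergy' μ + cst δ) ∂P + ENNReal.ofReal (1 / 12) * ∫⁻ μ, errTerm L μ ∂P := by
          rw [lintegral_add_left (hmeasI.const_mul _), lintegral_const_mul _ hmeasI,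
            lintegral_const_mul _ (measurable_errTerm _)]
  refine hstep.trans ?_
  gcongr
  -- `E_P[ofReal (h' + C_δ)] = ofReal (E_P[h] + C_δ) ≤ ofReal (e* + C_δ)`
  have hbounds : ∀ᵐ μ ∂P, 0 ≤ rootEnergy' μ + cst δ ∧ rootEnergy' μ + cst δ ≤ cst δ + 250 / 24 * δ⁻¹ ^ 12 :=
    hcore.mono fun μ hμ => by
      obtain ⟨h1, h2⟩ := rootEnergy'_bounds_of_hc hδ hμ
      unfold cst
      constructor <;> linarith
  have hC0 : 0 ≤ cst δ := cst_nonneg δ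
  have hK0 : (0 : ℝ) ≤ 250 / 24 * δ⁻¹ ^ 12 := by positivity
  have hint' : Integrable rootEnergy' P := by
    refine Integrable.of_bound measurable_rootEnergy'.aestronglyMeasurable
      (cst δ + 250 / 24 * δ⁻¹ ^ 12) (hbounds.mono fun μ hμ => ?_)
    rw [Real.norm_eq_abs, abs_le]
    constructor <;> linarith [hμ.1, hμ.2]
  have hint : Integrable (fun μ => rootEnergy' μ + cst δ) P := hint'.add (integrable_const _)
  have hnn : 0 ≤ᵐ[P] fun μ => rootEnergy' μ + cst δ := hbounds.mono fun μ hμ => hμ.1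
  rw [← ofReal_integral_eq_lintegral_ofReal hint hnn]
  have hae : (fun μ : Measure (EuclideanSpace ℝ (Fin 3)) => rootEnergy lennardJones μ) =ᵐ[P]
      rootEnergy' := hcore.mono fun μ hμ => by
    show rootEnergy lennardJones μ = rootEnergy' μ
    rw [Literature.MathematicalPhysics.StatisticalMechanics.rootEnergy_def]
    exact (rootEnergy'_eq_of_hc hδ hμ).symm
  have hI : ∫ μ, (rootEnergy' μ + cst δ) ∂P = (∫ μ, rootEnergy lennardJones μ ∂P) + cst δ := by
    rw [integral_add hint' (integrable_const _), integral_const, probReal_univ, one_smul,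
      integral_congr_ae hae]
  rw [hI]
  exact ENNReal.ofReal_le_ofReal (by linarith)

/-- **Registered form** (stub `cellAvg_energy_bound` of crux stmt-AtomisticToContinuum-11960): the
mean of the cell-averaged energy functional of a minimising point-stationary hard-core law.
[folklore] -/
theorem cellAvg_energy_bound : ∀ (δ L : ℝ), 0 < δ → 0 < L → ∀ (P : Measure (Measure (EuclideanSpace ℝ (Fin 3)))), IsProbabilityMeasure P → (∀ᵐ μ ∂P, IsRootedHardCore δ μ) → IsPointStationaryLaw P → (∫ μ, rootEnergy lennardJones μ ∂P) ≤ eStar → ∫⁻ μ, (∫⁻ v in phaseDom, (∫⁻ y in rootCell L v, ENNReal.ofReal (locEnergy δ (μ.map fun z => z - y) (rootCell L (v - L⁻¹ • y)) + cst δ) ∂μ) / μ (rootCell L v)) ∂P ≤ volume phaseDom * ENNReal.ofReal (eStar + cst δ) + ENNReal.ofReal (1 / 12) * ∫⁻ μ, errTerm L μ ∂P :=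
  fun _ _ hδ hL P _ hcore hstat hE => lintegral_cellAvg_energy_le hδ hL P hcore hstat hE

end Summit.AtomisticToContinuum.Crystallization.Theorems.SlackRigidityLawEnergy

end
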